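import Summits.BirchSwinnertonDyer.BirchSwinnertonDyer.Theorems.ManinLocalTwoThreeKummerDiamondDescentStepTwoPrelims
import Summits.BirchSwinnertonDyer.BirchSwinnertonDyer.Theorems.ManinLocalTwoThreeKummerDiamondDescentCases
import HarnessLib

/-!
# E-es-185 STEP 2 (MEMO-es §59.5), `E`-FREE: from the Kummer–diamond classes `h_q` of the Atkin–Lehner cusps to the
# four-case descent table (`2⁵ ∣ N`, `p ≡ 3 (mod 4)`, `δ(T₁), δ(T₂) ∈ {(2, d), (1, −p)}`)
(route `ManinLocalTwoThree`, crux C2 `ManinOddAtFour` stmt-BirchSwinnertonDyer-22967; cell bsd-f2-manin, C2/C3 LEAD p1 gen 19;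
`--supports stmt-BirchSwinnertonDyer-22967`; line card `Lines/kummer_diamond.md` item D6; consumer: p759380 `…KummerDiamondDescentCases`)

SETTING (what THEOREM K + Manin–Drinfeld + LEMMA M + surjectivity of `ϖ` deliver, written without any elliptic curve).  `0 < A < B`
are the ordered root differences of the Legendre model `y² = x(x − A)(x − B)` of `W₀` (so `δ(T₁) = ([AB], [−A])`, `δ(T₂) = ([A], [A(A−B)])`
in `(ℚˣ/ℚˣ²)²`, classes `WeierstrassCurve.Affine.sqClass`).  For each prime `q ∣ N` a pair of square-free INTEGER representatives
`(D₁ q, D₂ q)` of the class `h_q = δ(R_{q^{v_q(N)}})`: of conductor `q` (`D ∈ {1, q*}` for odd `q`, `D ∈ {±1, ±2}` for `q = 2`, and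
`D ∈ {±1}` at `2` unless `2⁵ ∣ N` — LEMMA M), all `h_q` and `δ(T₁), δ(T₂)` inside one subgroup `{1, v₁, v₂, v₁v₂}` (`⊇ δ(E(ℚ)_tors)`),
the images SPAN (`∃ q, D₁ q ≠ 1`, `∃ q, D₂ q ≠ 1`, `∃ q, D₁ q ≠ D₂ q` — `ϖ` is onto `K ≅ (ℤ/2)²`) and the SIGN condition
`∏ D₁ q > 0`, `∏ D₂ q > 0` (`ϖ(−1) = 0`).  CONCLUSION (`descent_table_of_diamond_classes`): `2⁵ ∣ N` and the hypothesis of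
`KummerDiamondCases.legendre_descent_cases` for some prime `p ∣ N`, `p ≡ 3 (mod 4)`, and `δ = [d]`, `d ∈ {−1, −2}`.
The proof is es's STEP 2 made elementary: nonzero classes at distinct primes are independent (`v_q`-parity), so exactly two primes
carry a nonzero class, they generate the 4-group, `δ(T₁), δ(T₂)` are the two ODD elements, the odd prime is `≡ 3 (mod 4)` with class
`(1, −p)`, and the even one must be `(2, d)` (else all first coordinates are trivial), which LEMMA M forbids unless `2⁵ ∣ N`.

HONEST FRAMING: SUPPORT lemma (elementary); THEOREM K (Stevens 1982 Thm. 1.3.1(b)) and Manin–Drinfeld at `w_Q∞` are NOT here;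
nothing about C2, Manin's conjecture or BSD is proved; C2/C3 OPEN as filed.
-/

set_option autoImplicit false
-- lint-debt: the directory name repeats the summit name (sibling precedent `ManinLocalTwoThreeKummerDiamondDescentCases.lean`)
set_option linter.dupNamespace false

noncomputable section

open WeierstrassCurve WeierstrassCurve.Affine
open Summit.BirchSwinnertonDyer.Rank1Residual.ManinAdditive.KummerDiamond

namespace Summit.BirchSwinnertonDyer.BirchSwinnertonDyer.Theorems.ManinLocalTwoThree.KummerDiamondStepTwo

/-! ## STEP 2 (main theorem; preliminaries in `…DescentStepTwoPrelims`) -/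

/-- **E-es-185 STEP 2, `E`-free (§59.5).**  See the module docstring for the dictionary.  Hypotheses: `0 < A < B`; for every prime
`q ∣ N` integer representatives `D₁ q, D₂ q` of conductor `q` (`hodd`, `htwo`) obeying LEMMA M at `2` (`hM`); a four-set
`{1, v₁, v₂, v₁v₂} ⊆ (ℚˣ/ℚˣ²)²` containing every `([D₁ q], [D₂ q])` and `δ(T₁) = ([AB], [−A])`, `δ(T₂) = ([A], [A(A−B)])` (`hV`, `ht₁`,
`ht₂`); SPANNING (`hspan₁₂₃`) and SIGN (`hsign₁₂`).  Conclusion: `2⁵ ∣ N`, and for some prime `p ∣ N` with `p ≡ 3 (mod 4)` and some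
`d ∈ {−1, −2}`, each of `δ(T₁)`, `δ(T₂)` is `([2], [d])` or `(1, [−p])` — the hypothesis of `KummerDiamondCases.legendre_descent_cases`.
[cite: Stevens1989, §2] [cite: SilvermanAEC2009, Prop. X.1.4] -/
theorem descent_table_of_diamond_classes {A B : ℚ} (hA0 : 0 < A) (hAB : A < B) {N : ℕ} (D₁ D₂ : ℕ → ℤ)
    (hodd : ∀ q ∈ N.primeFactors, q ≠ 2 →
      (D₁ q = 1 ∨ (D₁ q = q ∧ q % 4 = 1) ∨ (D₁ q = -q ∧ q % 4 = 3)) ∧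
      (D₂ q = 1 ∨ (D₂ q = q ∧ q % 4 = 1) ∨ (D₂ q = -q ∧ q % 4 = 3)))
    (htwo : 2 ∈ N.primeFactors →
      (D₁ 2 = 1 ∨ D₁ 2 = -1 ∨ D₁ 2 = 2 ∨ D₁ 2 = -2) ∧ (D₂ 2 = 1 ∨ D₂ 2 = -1 ∨ D₂ 2 = 2 ∨ D₂ 2 = -2))
    (hM : ¬ 2 ^ 5 ∣ N → 2 ∈ N.primeFactors → (D₁ 2 = 1 ∨ D₁ 2 = -1) ∧ (D₂ 2 = 1 ∨ D₂ 2 = -1))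
    (v₁ v₂ : SqUnits ℚ × SqUnits ℚ)
    (hV : ∀ q ∈ N.primeFactors,
      (sqClass (D₁ q : ℚ), sqClass (D₂ q : ℚ)) = (1 : SqUnits ℚ × SqUnits ℚ) ∨
      (sqClass (D₁ q : ℚ), sqClass (D₂ q : ℚ)) = v₁ ∨ (sqClass (D₁ q : ℚ), sqClass (D₂ q : ℚ)) = v₂ ∨
      (sqClass (D₁ q : ℚ), sqClass (D₂ q : ℚ)) = v₁ * v₂)
    (ht₁ : (sqClass (A * B), sqClass (-A)) = (1 : SqUnits ℚ × SqUnits ℚ) ∨ (sqClass (A * B), sqClass (-A)) = v₁ ∨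
      (sqClass (A * B), sqClass (-A)) = v₂ ∨ (sqClass (A * B), sqClass (-A)) = v₁ * v₂)
    (ht₂ : (sqClass A, sqClass (A * (A - B))) = (1 : SqUnits ℚ × SqUnits ℚ) ∨ (sqClass A, sqClass (A * (A - B))) = v₁ ∨
      (sqClass A, sqClass (A * (A - B))) = v₂ ∨ (sqClass A, sqClass (A * (A - B))) = v₁ * v₂)
    (hspan₁ : ∃ q ∈ N.primeFactors, D₁ q ≠ 1) (hspan₂ : ∃ q ∈ N.primeFactors, D₂ q ≠ 1)
    (hspan₃ : ∃ q ∈ N.primeFactors, D₁ q ≠ D₂ q)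
    (hsign₁ : 0 < ∏ q ∈ N.primeFactors, D₁ q) (hsign₂ : 0 < ∏ q ∈ N.primeFactors, D₂ q) :
    2 ^ 5 ∣ N ∧ ∃ p ∈ N.primeFactors, p % 4 = 3 ∧ ∃ d : ℤ, (d = -1 ∨ d = -2) ∧
      ((sqClass (A * B) = sqClass (2 : ℚ) ∧ sqClass (-A) = sqClass (d : ℚ)) ∨
        (sqClass (A * B) = 1 ∧ sqClass (-A) = sqClass (-(p : ℚ)))) ∧
      ((sqClass A = sqClass (2 : ℚ) ∧ sqClass (A * (A - B)) = sqClass (d : ℚ)) ∨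
        (sqClass A = 1 ∧ sqClass (A * (A - B)) = sqClass (-(p : ℚ)))) := by
  classical
  set PF := N.primeFactors with hPF
  have hprime : ∀ q ∈ PF, q.Prime := fun q hq => Nat.prime_of_mem_primeFactors hq
  -- exponent 2 on `G = (ℚˣ/ℚˣ²)²`
  have hG : ∀ g : SqUnits ℚ × SqUnits ℚ, g * g = 1 := fun g => Prod.ext (SqUnits.mul_self _) (SqUnits.mul_self _)
  -- representatives are non-zero; unified shape `D = 1 ∨ D = -1 (only at 2) ∨ D = ±q`
  have hrep : ∀ q ∈ PF, (D₁ q = 1 ∨ D₁ q = q ∨ D₁ q = -q ∨ (q = 2 ∧ D₁ q = -1)) ∧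
      (D₂ q = 1 ∨ D₂ q = q ∨ D₂ q = -q ∨ (q = 2 ∧ D₂ q = -1)) := by
    intro q hq
    by_cases h2 : q = 2
    · subst h2
      obtain ⟨h₁, h₂⟩ := htwo hq
      refine ⟨?_, ?_⟩
      · rcases h₁ with h | h | h | h
        · exact Or.inl h
        · exact Or.inr (Or.inr (Or.inr ⟨rfl, h⟩))
        · exact Or.inr (Or.inl (by exact_mod_cast h))
        · exact Or.inr (Or.inr (Or.inl (by exact_mod_cast h)))
      · rcases h₂ with h | h | h | h
        · exact Or.inl h
        · exact Or.inr (Or.inr (Or.inr ⟨rfl, h⟩))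
        · exact Or.inr (Or.inl (by exact_mod_cast h))
        · exact Or.inr (Or.inr (Or.inl (by exact_mod_cast h)))
    · obtain ⟨h₁, h₂⟩ := hodd q hq h2
      refine ⟨?_, ?_⟩
      · rcases h₁ with h | ⟨h, -⟩ | ⟨h, -⟩
        · exact Or.inl h
        · exact Or.inr (Or.inl h)
        · exact Or.inr (Or.inr (Or.inl h))
      · rcases h₂ with h | ⟨h, -⟩ | ⟨h, -⟩
        · exact Or.inl h
        · exact Or.inr (Or.inl h)
        · exact Or.inr (Or.inr (Or.inl h))
  have hD0 : ∀ q ∈ PF, ∀ D : ℤ, (D = 1 ∨ D = q ∨ D = -q ∨ (q = 2 ∧ D = -1)) → (D : ℚ) ≠ 0 :=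
    fun q hq D hD => rep_cast_ne_zero (hprime q hq) hD
  have hNT : ∀ q ∈ PF, ∀ D : ℤ, (D = 1 ∨ D = q ∨ D = -q ∨ (q = 2 ∧ D = -1)) → sqClass (D : ℚ) = 1 → D = 1 :=
    fun q hq D hD h1 => rep_eq_one_of_sqClass_eq_one (hprime q hq) hD h1
  have hind2 : ∀ q ∈ PF, ∀ q' ∈ PF, q ≠ q' → ¬ (D₁ q = 1 ∧ D₂ q = 1) → ¬ (D₁ q' = 1 ∧ D₂ q' = 1) →
      (sqClass (D₁ q : ℚ), sqClass (D₂ q : ℚ)) * (sqClass (D₁ q' : ℚ), sqClass (D₂ q' : ℚ)) ≠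
        (1 : SqUnits ℚ × SqUnits ℚ) :=
    fun q hq q' hq' hne hnt hnt' => indep_two (hprime q hq) (hprime q' hq') hne (hrep q hq).1 (hrep q hq).2
      (hrep q' hq').1 (hrep q' hq').2 hnt hnt'
  have hind3 : ∀ q ∈ PF, ∀ q' ∈ PF, ∀ q'' ∈ PF, q ≠ q' → q ≠ q'' → q' ≠ q'' →
      ¬ (D₁ q = 1 ∧ D₂ q = 1) → ¬ (D₁ q' = 1 ∧ D₂ q' = 1) → ¬ (D₁ q'' = 1 ∧ D₂ q'' = 1) →
      (sqClass (D₁ q : ℚ), sqClass (D₂ q : ℚ)) * ((sqClass (D₁ q' : ℚ), sqClass (D₂ q' : ℚ)) *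
        (sqClass (D₁ q'' : ℚ), sqClass (D₂ q'' : ℚ))) ≠ (1 : SqUnits ℚ × SqUnits ℚ) :=
    fun q hq q' hq' q'' hq'' hne hne' hne'' hnt hnt' _ => indep_three (hprime q hq) (hprime q' hq') (hprime q'' hq'')
      hne hne' hne'' (hrep q hq).1 (hrep q hq).2 (hrep q' hq').1 (hrep q' hq').2 (hrep q'' hq'').1 (hrep q'' hq'').2 hnt hnt'
  -- STEP a: a first non-trivial prime
  obtain ⟨q₁, hq₁, hq₁D⟩ := hspan₁
  have hnt₁ : ¬ (D₁ q₁ = 1 ∧ D₂ q₁ = 1) := fun h => hq₁D h.1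
  -- STEP b: a second one
  have hsecond : ∃ q₂ ∈ PF, q₂ ≠ q₁ ∧ ¬ (D₁ q₂ = 1 ∧ D₂ q₂ = 1) := by
    by_contra hnone
    have hall : ∀ q ∈ PF, q ≠ q₁ → D₁ q = 1 ∧ D₂ q = 1 := by
      intro q hq hne
      by_contra h
      exact hnone ⟨q, hq, hne, h⟩
    -- spanning witnesses all sit at `q₁`
    obtain ⟨q, hq, hqD⟩ := hspan₂
    have hD2q₁ : D₂ q₁ ≠ 1 := by
      by_cases h : q = q₁
      · exact h ▸ hqD
      · exact absurd (hall q hq h).2 hqD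
    obtain ⟨q', hq', hq'D⟩ := hspan₃
    have hneqD : D₁ q₁ ≠ D₂ q₁ := by
      by_cases h : q' = q₁
      · exact h ▸ hq'D
      · exact absurd ((hall q' hq' h).1.trans (hall q' hq' h).2.symm) hq'D
    -- signs: the products reduce to the `q₁` factor
    have hs₁ : 0 < D₁ q₁ := by
      rwa [Finset.prod_eq_single_of_mem q₁ hq₁ (fun q hq hne => (hall q hq hne).1)] at hsign₁
    have hs₂ : 0 < D₂ q₁ := by
      rwa [Finset.prod_eq_single_of_mem q₁ hq₁ (fun q hq hne => (hall q hq hne).2)] at hsign₂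
    have hq₁0 : (0 : ℤ) < q₁ := by exact_mod_cast (hprime q₁ hq₁).pos
    by_cases h2 : q₁ = 2
    · subst h2
      obtain ⟨h₁, h₂⟩ := htwo hq₁
      omega
    · obtain ⟨h₁, h₂⟩ := hodd q₁ hq₁ h2
      omega
  obtain ⟨q₂, hq₂, hne₂₁, hnt₂⟩ := hsecond
  -- names for the two classes
  set a : SqUnits ℚ × SqUnits ℚ := (sqClass (D₁ q₁ : ℚ), sqClass (D₂ q₁ : ℚ)) with ha_def
  set b : SqUnits ℚ × SqUnits ℚ := (sqClass (D₁ q₂ : ℚ), sqClass (D₂ q₂ : ℚ)) with hb_def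
  have ha1 : a ≠ 1 := by
    intro h
    rw [ha_def, Prod.mk_eq_one] at h
    exact hnt₁ ⟨hNT q₁ hq₁ _ (hrep q₁ hq₁).1 h.1, hNT q₁ hq₁ _ (hrep q₁ hq₁).2 h.2⟩
  have hb1 : b ≠ 1 := by
    intro h
    rw [hb_def, Prod.mk_eq_one] at h
    exact hnt₂ ⟨hNT q₂ hq₂ _ (hrep q₂ hq₂).1 h.1, hNT q₂ hq₂ _ (hrep q₂ hq₂).2 h.2⟩
  have hab : a * b ≠ 1 := hind2 q₁ hq₁ q₂ hq₂ hne₂₁.symm hnt₁ hnt₂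
  have haV := hV q₁ hq₁
  have hbV := hV q₂ hq₂
  -- STEP c: every other prime is trivial
  have hothers : ∀ q ∈ PF, q ≠ q₁ → q ≠ q₂ → D₁ q = 1 ∧ D₂ q = 1 := by
    intro q hq hne1 hne2
    by_contra hnt
    have hx := fourSet_eq_of_two_mem hG v₁ v₂ haV hbV ha1 hb1 hab (hV q hq)
    rcases hx with h | h | h | h
    · rw [Prod.mk_eq_one] at h
      exact hnt ⟨hNT q hq _ (hrep q hq).1 h.1, hNT q hq _ (hrep q hq).2 h.2⟩
    · -- `h_q = a` ⟹ `h_q · a = 1`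
      exact hind2 q hq q₁ hq₁ hne1 hnt hnt₁ (by rw [← ha_def, h]; exact hG a)
    · exact hind2 q hq q₂ hq₂ hne2 hnt hnt₂ (by rw [← hb_def, h]; exact hG b)
    · exact hind3 q hq q₁ hq₁ q₂ hq₂ hne1 hne2 hne₂₁.symm hnt hnt₁ hnt₂
        (by rw [← ha_def, ← hb_def, h]; exact hG _)
  -- STEP d: signs reduce to the two primes
  have hs₁ : 0 < D₁ q₁ * D₁ q₂ := by
    rwa [Finset.prod_eq_mul q₁ q₂ hne₂₁.symm (fun q hq hne => (hothers q hq hne.1 hne.2).1)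
      (fun h => absurd hq₁ h) (fun h => absurd hq₂ h)] at hsign₁
  have hs₂ : 0 < D₂ q₁ * D₂ q₂ := by
    rwa [Finset.prod_eq_mul q₁ q₂ hne₂₁.symm (fun q hq hne => (hothers q hq hne.1 hne.2).2)
      (fun h => absurd hq₁ h) (fun h => absurd hq₂ h)] at hsign₂
  -- STEP e: `t₁, t₂ ∈ {a, b}` (they are odd: second coordinate negative)
  have hA : A ≠ 0 := hA0.ne'
  have hB0 : 0 < B := hA0.trans hAB
  have hnegA : -A < 0 := by linarith
  have hAAB : A * (A - B) < 0 := mul_neg_of_pos_of_neg hA0 (by linarith)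
  have hABpos : 0 < A * B := mul_pos hA0 hB0
  have hD₂0₁ := hD0 q₁ hq₁ _ (hrep q₁ hq₁).2
  have hD₂0₂ := hD0 q₂ hq₂ _ (hrep q₂ hq₂).2
  have hD₁0₁ := hD0 q₁ hq₁ _ (hrep q₁ hq₁).1
  have hD₁0₂ := hD0 q₂ hq₂ _ (hrep q₂ hq₂).1
  have odd_mem : ∀ {x y : ℚ}, 0 < x → y < 0 →
      ((sqClass x, sqClass y) = (1 : SqUnits ℚ × SqUnits ℚ) ∨ (sqClass x, sqClass y) = v₁ ∨
        (sqClass x, sqClass y) = v₂ ∨ (sqClass x, sqClass y) = v₁ * v₂) →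
      ((sqClass x, sqClass y) = a ∨ (sqClass x, sqClass y) = b) := by
    intro x y hx hy hmem
    rcases fourSet_eq_of_two_mem hG v₁ v₂ haV hbV ha1 hb1 hab hmem with h | h | h | h
    · rw [Prod.mk_eq_one] at h
      exact absurd h.2 (sqClass_ne_one_of_neg hy)
    · exact Or.inl h
    · exact Or.inr h
    · exfalso
      rw [Prod.mk_mul_mk, ← sqClass_mul hD₂0₁ hD₂0₂, Prod.mk.injEq] at h
      have := mul_pos_of_sqClass_eq hy.ne (mul_ne_zero hD₂0₁ hD₂0₂) h.2
      have h' : (0 : ℚ) < (D₂ q₁ : ℚ) * (D₂ q₂ : ℚ) := by exact_mod_cast hs₂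
      nlinarith
  have ht₁' := odd_mem hABpos hnegA ht₁
  have ht₂' := odd_mem hA0 hAAB ht₂
  -- STEP f: sign pattern `(+, −)` at both primes
  have hsigns : 0 < D₁ q₁ ∧ 0 < D₁ q₂ ∧ D₂ q₁ < 0 ∧ D₂ q₂ < 0 := by
    rcases ht₁' with h | h
    · rw [ha_def, Prod.mk.injEq] at h
      have h1 := mul_pos_of_sqClass_eq hABpos.ne' hD₁0₁ h.1
      have h2 := mul_pos_of_sqClass_eq hnegA.ne hD₂0₁ h.2
      have e1 : (0 : ℚ) < D₁ q₁ := by nlinarith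
      have e2 : (D₂ q₁ : ℚ) < 0 := by nlinarith
      have e1' : 0 < D₁ q₁ := by exact_mod_cast e1
      have e2' : D₂ q₁ < 0 := by exact_mod_cast e2
      refine ⟨e1', ?_, e2', ?_⟩ <;> nlinarith
    · rw [hb_def, Prod.mk.injEq] at h
      have h1 := mul_pos_of_sqClass_eq hABpos.ne' hD₁0₂ h.1
      have h2 := mul_pos_of_sqClass_eq hnegA.ne hD₂0₂ h.2
      have e1 : (0 : ℚ) < D₁ q₂ := by nlinarith
      have e2 : (D₂ q₂ : ℚ) < 0 := by nlinarith
      have e1' : 0 < D₁ q₂ := by exact_mod_cast e1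
      have e2' : D₂ q₂ < 0 := by exact_mod_cast e2
      refine ⟨?_, e1', ?_, e2'⟩ <;> nlinarith
  obtain ⟨hp₁, hp₂, hn₁, hn₂⟩ := hsigns
  -- STEP g: the shape of the class at an odd prime among `q₁, q₂`: `(1, −q)` with `q ≡ 3 (mod 4)`
  have hodd_shape : ∀ q ∈ PF, q ≠ 2 → 0 < D₁ q → D₂ q < 0 → D₁ q = 1 ∧ D₂ q = -q ∧ q % 4 = 3 := by
    intro q hq hq2 hpos hneg
    have hq0 : (0 : ℤ) < q := by exact_mod_cast (hprime q hq).pos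
    obtain ⟨h₁, h₂⟩ := hodd q hq hq2
    omega
  -- STEP h: one of the two primes is `2`
  have htwo_mem : q₁ = 2 ∨ q₂ = 2 := by
    by_cases h1 : q₁ = 2
    · exact Or.inl h1
    -- `q₁` odd with sign pattern `(+, −)` has `D₁ q₁ = 1`: contradicts the choice of `q₁`
    exact absurd (hodd_shape q₁ hq₁ h1 hp₁ hn₁).1 hq₁D
  -- STEP i: finish, with `e = 2` and `p` the odd one
  have finish : ∀ e ∈ PF, ∀ p ∈ PF, e = 2 → p ≠ e → 0 < D₁ e → D₂ e < 0 → 0 < D₁ p → D₂ p < 0 →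
      (∀ q ∈ PF, q ≠ e → q ≠ p → D₁ q = 1 ∧ D₂ q = 1) →
      (((sqClass (A * B), sqClass (-A)) = (sqClass (D₁ e : ℚ), sqClass (D₂ e : ℚ)) ∨
        (sqClass (A * B), sqClass (-A)) = (sqClass (D₁ p : ℚ), sqClass (D₂ p : ℚ)))) →
      (((sqClass A, sqClass (A * (A - B))) = (sqClass (D₁ e : ℚ), sqClass (D₂ e : ℚ)) ∨
        (sqClass A, sqClass (A * (A - B))) = (sqClass (D₁ p : ℚ), sqClass (D₂ p : ℚ)))) →
      2 ^ 5 ∣ N ∧ ∃ p ∈ N.primeFactors, p % 4 = 3 ∧ ∃ d : ℤ, (d = -1 ∨ d = -2) ∧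
        ((sqClass (A * B) = sqClass (2 : ℚ) ∧ sqClass (-A) = sqClass (d : ℚ)) ∨
          (sqClass (A * B) = 1 ∧ sqClass (-A) = sqClass (-(p : ℚ)))) ∧
        ((sqClass A = sqClass (2 : ℚ) ∧ sqClass (A * (A - B)) = sqClass (d : ℚ)) ∨
          (sqClass A = 1 ∧ sqClass (A * (A - B)) = sqClass (-(p : ℚ)))) := by
    intro e he p hp he2 hpe hpe₁ hne₁ hpp₁ hnp₁ hoth hT₁ hT₂
    subst he2
    obtain ⟨hDp₁, hDp₂, hp4⟩ := hodd_shape p hp hpe hpp₁ hnp₁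
    obtain ⟨h2₁, h2₂⟩ := htwo he
    -- `D₁ 2 = 2`: otherwise all first coordinates are `1`
    have hD₁2 : D₁ 2 = 2 := by
      rcases h2₁ with h | h | h | h
      · exfalso
        -- every `D₁ q = 1`: contradiction with `hspan₁`'s witness `q₁ ∈ {2, p, others}`
        have hall : ∀ q ∈ PF, D₁ q = 1 := by
          intro q hq
          by_cases hq2 : q = 2
          · exact hq2 ▸ h
          by_cases hqp : q = p
          · exact hqp ▸ hDp₁
          · exact (hoth q hq hq2 hqp).1
        exact hq₁D (hall q₁ hq₁)
      · omega
      · exact h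
      · omega
    have hd : D₂ 2 = -1 ∨ D₂ 2 = -2 := by omega
    refine ⟨?_, p, hp, hp4, D₂ 2, hd, ?_, ?_⟩
    · by_contra h32
      have := (hM h32 he).1
      omega
    · rcases hT₁ with h | h
      · left
        rw [Prod.mk.injEq, hD₁2] at h
        exact ⟨by rw [h.1]; push_cast; rfl, h.2⟩
      · right
        rw [Prod.mk.injEq, hDp₁, hDp₂] at h
        exact ⟨by rw [h.1]; push_cast; exact sqClass_one, by rw [h.2]; push_cast; rfl⟩
    · rcases hT₂ with h | h
      · left
        rw [Prod.mk.injEq, hD₁2] at h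
        exact ⟨by rw [h.1]; push_cast; rfl, h.2⟩
      · right
        rw [Prod.mk.injEq, hDp₁, hDp₂] at h
        exact ⟨by rw [h.1]; push_cast; exact sqClass_one, by rw [h.2]; push_cast; rfl⟩
  rcases htwo_mem with rfl | rfl
  · exact finish 2 hq₁ q₂ hq₂ rfl hne₂₁ hp₁ hn₁ hp₂ hn₂
      (fun q hq hne hne' => hothers q hq hne hne') ht₁' ht₂'
  · exact finish 2 hq₂ q₁ hq₁ rfl hne₂₁.symm hp₂ hn₂ hp₁ hn₁
      (fun q hq hne hne' => hothers q hq hne' hne) (ht₁'.symm) (ht₂'.symm)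

/-! ## STEP 2 + STEP 3: the `E`-free end of E-es-185 -/

/-- **E-es-185, STEPS 2–3 combined (`E`-free).**  A Weierstrass curve `W/ℚ` carried by some change of variables to the Legendre model
`y² = x(x − A)(x − B)` with `0 < A < B`, together with Kummer–diamond class data `(D₁ q, D₂ q)_{q ∣ N}` as in
`descent_table_of_diamond_classes`, satisfies `2⁵ ∣ N` AND has the Frey-twist shape `y² = x(x − 2s²)(x − t²)`, `s` even, `t` odd
(`KummerDiamond.HasFreyTwistShape W`) — by `descent_table_of_diamond_classes` and p759380
`KummerDiamondCases.hasFreyTwistShape_of_legendre_descent_cases`.  What remains of E-es-185 in Lean is to PRODUCE these data from an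
index-`4` configuration: THEOREM K (Stevens 1982 Thm. 1.3.1(b)) + Manin–Drinfeld at `w_Q∞` + LEMMA M (p758315) + `ϖ` onto `Λ₀/2Λ₀`.
[cite: Stevens1989, §2] [cite: SilvermanAEC2009, Prop. X.1.4] -/
theorem two_pow_five_dvd_and_hasFreyTwistShape_of_diamond_classes (W : WeierstrassCurve ℚ) {C : VariableChange ℚ} {A B : ℚ}
    (hC : C • W = ⟨0, -(A + B), 0, A * B, 0⟩) (hA0 : 0 < A) (hAB : A < B) {N : ℕ} (D₁ D₂ : ℕ → ℤ)
    (hodd : ∀ q ∈ N.primeFactors, q ≠ 2 →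
      (D₁ q = 1 ∨ (D₁ q = q ∧ q % 4 = 1) ∨ (D₁ q = -q ∧ q % 4 = 3)) ∧
      (D₂ q = 1 ∨ (D₂ q = q ∧ q % 4 = 1) ∨ (D₂ q = -q ∧ q % 4 = 3)))
    (htwo : 2 ∈ N.primeFactors →
      (D₁ 2 = 1 ∨ D₁ 2 = -1 ∨ D₁ 2 = 2 ∨ D₁ 2 = -2) ∧ (D₂ 2 = 1 ∨ D₂ 2 = -1 ∨ D₂ 2 = 2 ∨ D₂ 2 = -2))
    (hM : ¬ 2 ^ 5 ∣ N → 2 ∈ N.primeFactors → (D₁ 2 = 1 ∨ D₁ 2 = -1) ∧ (D₂ 2 = 1 ∨ D₂ 2 = -1))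
    (v₁ v₂ : SqUnits ℚ × SqUnits ℚ)
    (hV : ∀ q ∈ N.primeFactors,
      (sqClass (D₁ q : ℚ), sqClass (D₂ q : ℚ)) = (1 : SqUnits ℚ × SqUnits ℚ) ∨
      (sqClass (D₁ q : ℚ), sqClass (D₂ q : ℚ)) = v₁ ∨ (sqClass (D₁ q : ℚ), sqClass (D₂ q : ℚ)) = v₂ ∨
      (sqClass (D₁ q : ℚ), sqClass (D₂ q : ℚ)) = v₁ * v₂)
    (ht₁ : (sqClass (A * B), sqClass (-A)) = (1 : SqUnits ℚ × SqUnits ℚ) ∨ (sqClass (A * B), sqClass (-A)) = v₁ ∨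
      (sqClass (A * B), sqClass (-A)) = v₂ ∨ (sqClass (A * B), sqClass (-A)) = v₁ * v₂)
    (ht₂ : (sqClass A, sqClass (A * (A - B))) = (1 : SqUnits ℚ × SqUnits ℚ) ∨ (sqClass A, sqClass (A * (A - B))) = v₁ ∨
      (sqClass A, sqClass (A * (A - B))) = v₂ ∨ (sqClass A, sqClass (A * (A - B))) = v₁ * v₂)
    (hspan₁ : ∃ q ∈ N.primeFactors, D₁ q ≠ 1) (hspan₂ : ∃ q ∈ N.primeFactors, D₂ q ≠ 1)
    (hspan₃ : ∃ q ∈ N.primeFactors, D₁ q ≠ D₂ q)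
    (hsign₁ : 0 < ∏ q ∈ N.primeFactors, D₁ q) (hsign₂ : 0 < ∏ q ∈ N.primeFactors, D₂ q) :
    2 ^ 5 ∣ N ∧ HasFreyTwistShape W := by
  obtain ⟨h32, p, hp, hp4, d, -, hT₁, hT₂⟩ := descent_table_of_diamond_classes hA0 hAB D₁ D₂ hodd htwo hM v₁ v₂ hV ht₁ ht₂
    hspan₁ hspan₂ hspan₃ hsign₁ hsign₂
  exact ⟨h32, KummerDiamondCases.hasFreyTwistShape_of_legendre_descent_cases W hC hA0.ne' (hA0.trans hAB).ne' hAB.ne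
    (Nat.prime_of_mem_primeFactors hp) hp4 (sqClass (d : ℚ)) hT₁ hT₂⟩

end Summit.BirchSwinnertonDyer.BirchSwinnertonDyer.Theorems.ManinLocalTwoThree.KummerDiamondStepTwo

end
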